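import Mathlib
import Literature.Analysis.FluidPDE.VectorCalculus
import HarnessLib

/-!
# The retired tame disjuncts are sub-cases of IRROTATIONAL PIERCING (skeleton v43/v44 consolidation, kernel-checked)
# (crux `EulerZoomLiouville.PowerGaugeEulerLiouville` = stmt-NavierStokesRegularity-19832, line `birth`; interim LEAD ns-typeII-p2 g10)

From v44 on the lead skeleton's tame `C²` predicate reads `IsTameC2Profile ρ V := ContDiff ℝ 2 V ∧ (UniformContinuous V ∨ HasIrrotationalPiercing ρ V)`
with `HasIrrotationalPiercing ρ V := ∀ R₀, ∃ R ≥ R₀, ∀ y, ‖y‖ = R → ⟪y, V y⟫ ≤ −‖y‖²/(2+ρ) → curl V y = 0`.  This file records, as four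
elementary lemmas stated on the UNFOLDED predicate with a general rate `γ` (`γ = 1/(2+ρ)` in the skeleton), that the disjuncts of v22–v42 which
the consolidation dropped are sub-cases of piercing, so no filled stratum was lost:

* `piercing_of_radialBarrier` — no fast radial inflow at infinity, `∃ κ < γ, ∃ R₁, ∀ ‖y‖ ≥ R₁, −κ‖y‖² ≤ ⟪y, V y⟫` (v22's first disjunct);
* `piercing_of_sphereBarriers` — v38's barrier spheres, `∃ κ < γ, ∀ R₀, ∃ R ≥ R₀, ∀ ‖y‖ = R, −κ‖y‖² ≤ ⟪y, V y⟫`;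
* `piercing_of_curl_eq_zero` — irrotational profiles (v22's third disjunct);
* `piercing_of_hasCompactSupport_curl` — compactly supported vorticity (v21).

In the first two the fast-inflow premise is FALSE on the chosen spheres (a sphere of positive radius with `⟪y,Vy⟫ ≥ −κ‖y‖² > −γ‖y‖²`), in the
last two its conclusion holds outright.  Pure bookkeeping; no dynamics.

WHAT THIS IS NOT: not NS, not E — binder hygiene for THE ONE STATEMENT `Sig.stub_selfSimilarC2Needle` (v44:
`InClass → IsExactlySelfSimilar → IsExtremalProfile → ContDiff ℝ 2 V → ¬ HasIrrotationalPiercing ρ V → u =ᵐ 0`). [folklore]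
-/

noncomputable section

set_option linter.dupNamespace false

open Metric Function InnerProductSpace
open scoped RealInnerProductSpace

namespace Summit.NavierStokesRegularity.NavierStokesRegularity.Theorems.PowerGaugeEulerLiouville.Binders

open Literature.Analysis Literature.Analysis.FluidPDE

variable {γ : ℝ} {V : EuclideanSpace ℝ (Fin 3) → EuclideanSpace ℝ (Fin 3)}

/-- On a sphere of positive radius carrying the one-sided barrier `−κ‖y‖² ≤ ⟪y, V y⟫` with `κ < γ`, no point is a fast-inflow point:
`⟪y, V y⟫ ≤ −γ‖y‖²` is impossible. [folklore] -/
theorem not_fastInflow_of_barrier {κ R : ℝ} (hκ : κ < γ) (hR : 0 < R) {y : EuclideanSpace ℝ (Fin 3)} (hy : ‖y‖ = R)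
    (hbar : -(κ * ‖y‖ ^ 2) ≤ ⟪y, V y⟫) : ¬ ⟪y, V y⟫ ≤ -(γ * ‖y‖ ^ 2) := by
  intro hfast
  have hy2 : 0 < ‖y‖ ^ 2 := by rw [hy]; positivity
  have : γ * ‖y‖ ^ 2 ≤ κ * ‖y‖ ^ 2 := by linarith
  exact absurd (le_of_mul_le_mul_right this hy2) (not_le.2 hκ)

/-- **No fast radial inflow at infinity ⇒ irrotational piercing** (vacuously, on every sphere of radius `≥ max R₁ 1` beyond `R₀`). [folklore] -/
theorem piercing_of_radialBarrier {κ R₁ : ℝ} (hκ : κ < γ)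
    (hbar : ∀ y : EuclideanSpace ℝ (Fin 3), R₁ ≤ ‖y‖ → -(κ * ‖y‖ ^ 2) ≤ ⟪y, V y⟫) :
    ∀ R₀ : ℝ, ∃ R : ℝ, R₀ ≤ R ∧ ∀ y : EuclideanSpace ℝ (Fin 3), ‖y‖ = R →
      ⟪y, V y⟫ ≤ -(γ * ‖y‖ ^ 2) → curl V y = 0 := by
  intro R₀
  refine ⟨max R₀ (max R₁ 1), le_max_left _ _, fun y hy hfast => ?_⟩
  have hR : 0 < max R₀ (max R₁ 1) := lt_of_lt_of_le one_pos ((le_max_right _ _).trans (le_max_right _ _))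
  have hR₁ : R₁ ≤ ‖y‖ := by rw [hy]; exact (le_max_left _ _).trans (le_max_right _ _)
  exact absurd hfast (not_fastInflow_of_barrier hκ hR hy (hbar y hR₁))

/-- **Barrier spheres beyond every radius ⇒ irrotational piercing** (vacuously, on the barrier spheres of radius `≥ max R₀ 1`). [folklore] -/
theorem piercing_of_sphereBarriers {κ : ℝ} (hκ : κ < γ)
    (hS : ∀ R₀ : ℝ, ∃ R : ℝ, R₀ ≤ R ∧ ∀ y : EuclideanSpace ℝ (Fin 3), ‖y‖ = R → -(κ * ‖y‖ ^ 2) ≤ ⟪y, V y⟫) :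
    ∀ R₀ : ℝ, ∃ R : ℝ, R₀ ≤ R ∧ ∀ y : EuclideanSpace ℝ (Fin 3), ‖y‖ = R →
      ⟪y, V y⟫ ≤ -(γ * ‖y‖ ^ 2) → curl V y = 0 := by
  intro R₀
  obtain ⟨R, hR₀, hSR⟩ := hS (max R₀ 1)
  have hR : 0 < R := lt_of_lt_of_le one_pos ((le_max_right _ _).trans hR₀)
  exact ⟨R, (le_max_left _ _).trans hR₀, fun y hy hfast =>
    absurd hfast (not_fastInflow_of_barrier hκ hR hy (hSR y hy))⟩

/-- **Irrotational profile ⇒ irrotational piercing** (on every sphere). [folklore] -/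
theorem piercing_of_curl_eq_zero (hcurl : ∀ x : EuclideanSpace ℝ (Fin 3), curl V x = 0) :
    ∀ R₀ : ℝ, ∃ R : ℝ, R₀ ≤ R ∧ ∀ y : EuclideanSpace ℝ (Fin 3), ‖y‖ = R →
      ⟪y, V y⟫ ≤ -(γ * ‖y‖ ^ 2) → curl V y = 0 :=
  fun R₀ => ⟨R₀, le_rfl, fun y _ _ => hcurl y⟩

/-- **Compactly supported vorticity ⇒ irrotational piercing** (on every sphere beyond the support). [folklore] -/
theorem piercing_of_hasCompactSupport_curl (hΩc : HasCompactSupport (curl V)) :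
    ∀ R₀ : ℝ, ∃ R : ℝ, R₀ ≤ R ∧ ∀ y : EuclideanSpace ℝ (Fin 3), ‖y‖ = R →
      ⟪y, V y⟫ ≤ -(γ * ‖y‖ ^ 2) → curl V y = 0 := by
  intro R₀
  obtain ⟨M, hM⟩ := (hΩc.isCompact.isBounded).subset_closedBall (0 : EuclideanSpace ℝ (Fin 3))
  refine ⟨max R₀ (M + 1), le_max_left _ _, fun y hy _ => ?_⟩
  have hy' : y ∉ tsupport (curl V) := by
    intro hmem
    have := hM hmem
    rw [mem_closedBall, dist_zero_right, hy] at this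
    linarith [le_max_right R₀ (M + 1)]
  exact image_eq_zero_of_notMem_tsupport hy'

end Summit.NavierStokesRegularity.NavierStokesRegularity.Theorems.PowerGaugeEulerLiouville.Binders

end
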